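import Mathlib
import HarnessLib
import Summits.ResolutionOfSingularities.ResolutionOfSingularities.Theorems.WildQuotientsWildQuotientResolutionJordanFiveChartOneCover
import Summits.ResolutionOfSingularities.ResolutionOfSingularities.Theorems.WildQuotientsWildQuotientResolutionJordanFiveLociW2

/-!
# RUNG V5 (`J₅`): the cover `V[x_a³] ∪ chartW₁ ∪ chartW₂ ∪ V[x_d¹²] = Bl_{I₁₂} 𝔸ⁿ` (brick `Hcov`)
(crux stmt-ResolutionOfSingularities-15640 `WildQuotients.WildQuotientResolution`, line `Sketch`;
chain w45c RUNG V5 `JordanFive.jordanFive_hasResolution_of_bricks` (res-L1-w45c-lead-1 BRICK LIST v1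
`stubs/J5Bricks.lean` l.114: `Hcov : chart 0 ⊔ W₁ ⊔ W₂ ⊔ chart 3 = ⊤`), res-L1-w45c-plan-1 RULING 10:50Z
«stub-5 = (δ1) … + Hcov», = res-L1-w45c-idea-2's W₂ DESIGN LINE §5 (A)–(E) (W2-DESIGN.md
400ebbeeb3422d46) over res-L1-w45c-stub-1's terms `chartW₁` (p526168) / `chartW₂` (p528290); written by
res-D-pv-033 AS res-L1-w45c-stub-5. [OURS · L1 W4.5c] — NOT a statement of any manuscript.)

PROOF (idea-2 §5). The four vertex charts cover (`iSup_vertexCharts_eq_top`, p527406), so it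
suffices to place `V[x_b⁴]` and `V[x_c⁶]`: `V[x_b⁴] ⊆ V[x_a³] ∪ chartW₁`
(`chart_one_le_chart_zero_sup_chartW₁`); and for `v ∈ V[x_c⁶]` outside the four opens: `x_a³t`,
`x_d¹²t ∈ 𝔭_v`, `x_b⁴t ∈ 𝔭_v` (`reesT_one_mem_of_not_mem_chart_zero_chartW₁`), hence (uniform power
certificate, `…JordanFiveVertexPowers`) EVERY `g_j t`, `j ≠ 2`, lies in `𝔭_v`; off
`chartW₂ = D₊(i₂³t·(2j₃)²t)` one of `i₂³t ≡ x_c⁶t`, `(2j₃)²t ≡ 4x_c⁶t` lies in the prime `𝔭_v`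
(`…JordanFiveLociW2`), so `x_c⁶t ∈ 𝔭_v` (characteristic `≠ 2`) — contradicting `v ∈ V[x_c⁶]`.
* `JordanFive.reesT_gens12_mem_of_ne_two` — `x_a³t, x_b⁴t, x_d¹²t ∈ 𝔭 ⇒ g_j t ∈ 𝔭` for `j ≠ 2`;
* `JordanFive.chart_two_le` — `V[x_c⁶] ⊆ V[x_a³] ∪ chartW₁ ∪ chartW₂ ∪ V[x_d¹²]`;
* **`JordanFive.chart_zero_sup_chartW₁_sup_chartW₂_sup_chart_three_eq_top`** — `Hcov` VERBATIM at
  `W₁ := chartW₁ k n a b c d`, `W₂ := chartW₂ k n a b c d e`, under `(2 : k) ≠ 0`.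
-/

-- single-problem summit: the doubled namespace component `ResolutionOfSingularities` is forced
set_option linter.dupNamespace false

noncomputable section

open CategoryTheory AlgebraicGeometry TopologicalSpace MvPolynomial Polynomial
open Literature.AlgebraicGeometry.Resolution

namespace Summit.ResolutionOfSingularities.ResolutionOfSingularities.Theorems.WildQuotientResolution.JordanFive

variable (k : Type) [Field k] (n : ℕ) (a b c d e : Fin n)

-- 40 generator cases
set_option maxHeartbeats 2000000 in
/-- **If `x_a³t, x_b⁴t, x_d¹²t` lie in a prime `𝔭` of `k[x][I₁₂t]` then so does every `g_j t` with
`j ≠ 2`** (every generator other than `g₂ = x_c⁶` involves `x_a`, `x_b` or `x_d`; uniform power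
certificate). [OURS · L1 W4.5c] [folklore] -/
theorem reesT_gens12_mem_of_ne_two (𝔭 : Ideal (reesAlgebra (I12 k n a b c d))) (h𝔭 : 𝔭.IsPrime)
    (h0 : reesT (gens12 k n a b c d 0) (gens12_mem_I12 k n a b c d 0) ∈ 𝔭)
    (h1 : reesT (gens12 k n a b c d 1) (gens12_mem_I12 k n a b c d 1) ∈ 𝔭)
    (h3 : reesT (gens12 k n a b c d 3) (gens12_mem_I12 k n a b c d 3) ∈ 𝔭)
    (j : Fin 40) (hj : j ≠ 2) :
    reesT (gens12 k n a b c d j) (gens12_mem_I12 k n a b c d j) ∈ 𝔭 := by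
  fin_cases j
  · exact (reesT_gens12_mem_of_vertex_mem k n a b c d 𝔭 h𝔭 _).1 (by simp [exps12]) h0
  · exact (reesT_gens12_mem_of_vertex_mem k n a b c d 𝔭 h𝔭 _).2.1 (by simp [exps12]) h1
  · exact (hj rfl).elim
  · exact (reesT_gens12_mem_of_vertex_mem k n a b c d 𝔭 h𝔭 _).2.2.2 (by simp [exps12]) h3
  · exact (reesT_gens12_mem_of_vertex_mem k n a b c d 𝔭 h𝔭 _).1 (by simp [exps12]) h0
  · exact (reesT_gens12_mem_of_vertex_mem k n a b c d 𝔭 h𝔭 _).1 (by simp [exps12]) h0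
  · exact (reesT_gens12_mem_of_vertex_mem k n a b c d 𝔭 h𝔭 _).1 (by simp [exps12]) h0
  · exact (reesT_gens12_mem_of_vertex_mem k n a b c d 𝔭 h𝔭 _).1 (by simp [exps12]) h0
  · exact (reesT_gens12_mem_of_vertex_mem k n a b c d 𝔭 h𝔭 _).1 (by simp [exps12]) h0
  · exact (reesT_gens12_mem_of_vertex_mem k n a b c d 𝔭 h𝔭 _).1 (by simp [exps12]) h0
  · exact (reesT_gens12_mem_of_vertex_mem k n a b c d 𝔭 h𝔭 _).1 (by simp [exps12]) h0
  · exact (reesT_gens12_mem_of_vertex_mem k n a b c d 𝔭 h𝔭 _).1 (by simp [exps12]) h0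
  · exact (reesT_gens12_mem_of_vertex_mem k n a b c d 𝔭 h𝔭 _).1 (by simp [exps12]) h0
  · exact (reesT_gens12_mem_of_vertex_mem k n a b c d 𝔭 h𝔭 _).1 (by simp [exps12]) h0
  · exact (reesT_gens12_mem_of_vertex_mem k n a b c d 𝔭 h𝔭 _).1 (by simp [exps12]) h0
  · exact (reesT_gens12_mem_of_vertex_mem k n a b c d 𝔭 h𝔭 _).1 (by simp [exps12]) h0
  · exact (reesT_gens12_mem_of_vertex_mem k n a b c d 𝔭 h𝔭 _).1 (by simp [exps12]) h0
  · exact (reesT_gens12_mem_of_vertex_mem k n a b c d 𝔭 h𝔭 _).1 (by simp [exps12]) h0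
  · exact (reesT_gens12_mem_of_vertex_mem k n a b c d 𝔭 h𝔭 _).2.1 (by simp [exps12]) h1
  · exact (reesT_gens12_mem_of_vertex_mem k n a b c d 𝔭 h𝔭 _).2.1 (by simp [exps12]) h1
  · exact (reesT_gens12_mem_of_vertex_mem k n a b c d 𝔭 h𝔭 _).2.1 (by simp [exps12]) h1
  · exact (reesT_gens12_mem_of_vertex_mem k n a b c d 𝔭 h𝔭 _).2.1 (by simp [exps12]) h1
  · exact (reesT_gens12_mem_of_vertex_mem k n a b c d 𝔭 h𝔭 _).2.1 (by simp [exps12]) h1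
  · exact (reesT_gens12_mem_of_vertex_mem k n a b c d 𝔭 h𝔭 _).2.1 (by simp [exps12]) h1
  · exact (reesT_gens12_mem_of_vertex_mem k n a b c d 𝔭 h𝔭 _).2.1 (by simp [exps12]) h1
  · exact (reesT_gens12_mem_of_vertex_mem k n a b c d 𝔭 h𝔭 _).2.1 (by simp [exps12]) h1
  · exact (reesT_gens12_mem_of_vertex_mem k n a b c d 𝔭 h𝔭 _).2.1 (by simp [exps12]) h1
  · exact (reesT_gens12_mem_of_vertex_mem k n a b c d 𝔭 h𝔭 _).2.1 (by simp [exps12]) h1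
  · exact (reesT_gens12_mem_of_vertex_mem k n a b c d 𝔭 h𝔭 _).2.1 (by simp [exps12]) h1
  · exact (reesT_gens12_mem_of_vertex_mem k n a b c d 𝔭 h𝔭 _).2.2.2 (by simp [exps12]) h3
  · exact (reesT_gens12_mem_of_vertex_mem k n a b c d 𝔭 h𝔭 _).2.2.2 (by simp [exps12]) h3
  · exact (reesT_gens12_mem_of_vertex_mem k n a b c d 𝔭 h𝔭 _).2.2.2 (by simp [exps12]) h3
  · exact (reesT_gens12_mem_of_vertex_mem k n a b c d 𝔭 h𝔭 _).2.2.2 (by simp [exps12]) h3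
  · exact (reesT_gens12_mem_of_vertex_mem k n a b c d 𝔭 h𝔭 _).2.2.2 (by simp [exps12]) h3
  · exact (reesT_gens12_mem_of_vertex_mem k n a b c d 𝔭 h𝔭 _).1 (by simp [exps12]) h0
  · exact (reesT_gens12_mem_of_vertex_mem k n a b c d 𝔭 h𝔭 _).1 (by simp [exps12]) h0
  · exact (reesT_gens12_mem_of_vertex_mem k n a b c d 𝔭 h𝔭 _).1 (by simp [exps12]) h0
  · exact (reesT_gens12_mem_of_vertex_mem k n a b c d 𝔭 h𝔭 _).2.1 (by simp [exps12]) h1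
  · exact (reesT_gens12_mem_of_vertex_mem k n a b c d 𝔭 h𝔭 _).2.1 (by simp [exps12]) h1
  · exact (reesT_gens12_mem_of_vertex_mem k n a b c d 𝔭 h𝔭 _).1 (by simp [exps12]) h0

/-- **`V[x_c⁶] ⊆ V[x_a³] ∪ chartW₁ ∪ chartW₂ ∪ V[x_d¹²]`** (idea-2 W2-DESIGN §5 (C)(D)(E);
characteristic `≠ 2`). [OURS · L1 W4.5c] [folklore] -/
theorem chart_two_le (h2 : (2 : k) ≠ 0) :
    chart k n a b c d 2 ≤
      chart k n a b c d 0 ⊔ chartW₁ k n a b c d ⊔ chartW₂ k n a b c d e ⊔ chart k n a b c d 3 := by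
  intro v hv
  simp only [Opens.mem_sup]
  by_contra hcon
  simp only [not_or] at hcon
  obtain ⟨⟨⟨hv0, hvW1⟩, hvW2⟩, hv3⟩ := hcon
  have h𝔭 : v.asHomogeneousIdeal.toIdeal.IsPrime := v.isPrime
  have k0 := reesT_gens12_mem_of_not_mem_chart k n a b c d 0 v hv0
  have k3 := reesT_gens12_mem_of_not_mem_chart k n a b c d 3 v hv3
  have k1 := reesT_one_mem_of_not_mem_chart_zero_chartW₁ k n a b c d v hv0 hvW1
  have hoff : ∀ j : Fin 40, j ≠ 2 →
      reesT (gens12 k n a b c d j) (gens12_mem_I12 k n a b c d j) ∈ v.asHomogeneousIdeal.toIdeal :=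
    fun j hj => reesT_gens12_mem_of_ne_two k n a b c d _ h𝔭 k0 k1 k3 j hj
  have k2 : reesT (gens12 k n a b c d 2) (gens12_mem_I12 k n a b c d 2) ∉
      v.asHomogeneousIdeal.toIdeal := fun h =>
    (Proj.mem_basicOpen _ _ _).mp ((chart_eq_basicOpen k n a b c d 2) ▸ hv) h
  -- off `chartW₂`: the product section lies in `𝔭_v`
  have hprod : reesT (iTwo k n a b c d e ^ 3) (iTwo_cube_mem_I12 k n a b c d e) *
      reesT (jThreeTwo k n a b c d e ^ 2) (jThreeTwo_sq_mem_I12 k n a b c d e) ∈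
        v.asHomogeneousIdeal.toIdeal := by
    by_contra h
    exact hvW2 ((chartW₂_def k n a b c d e).symm ▸ (Proj.mem_basicOpen _ _ _).mpr h)
  rcases h𝔭.mem_or_mem hprod with hi | hj
  · exact k2 (reesT_two_mem_of_iTwo_cube_mem k n a b c d e _ (fun j hj => hoff j (by
      rcases hj with rfl | rfl | rfl | rfl | rfl | rfl | rfl | rfl | rfl | rfl | rfl | rfl | rfl |
        rfl | rfl <;> decide)) hi)
  · exact k2 (reesT_two_mem_of_jThreeTwo_sq_mem k n a b c d e h2 _ (fun j hj => hoff j (by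
      rcases hj with rfl | rfl | rfl | rfl | rfl | rfl | rfl | rfl | rfl | rfl | rfl | rfl | rfl |
        rfl | rfl | rfl | rfl | rfl | rfl | rfl | rfl <;> decide)) hj)

/-- **Brick `Hcov` of the J₅ toric exit** (`stubs/J5Bricks.lean` l.114 VERBATIM at
`W₁ := chartW₁ k n a b c d`, `W₂ := chartW₂ k n a b c d e`), in characteristic `≠ 2`:
**`V[x_a³] ∪ chartW₁ ∪ chartW₂ ∪ V[x_d¹²] = Bl_{I₁₂} 𝔸ⁿ`** — the `μ₄`-vertex chart, the twisted `μ₃`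
chart, the `μ₂`-HIGH open and the terminal chart cover the first floor. [OURS · L1 W4.5c] [folklore;
idea-2 W2-DESIGN §5] -/
theorem chart_zero_sup_chartW₁_sup_chartW₂_sup_chart_three_eq_top (h2 : (2 : k) ≠ 0) :
    chart k n a b c d 0 ⊔ chartW₁ k n a b c d ⊔ chartW₂ k n a b c d e ⊔ chart k n a b c d 3 = ⊤ := by
  refine top_le_iff.mp ?_
  rw [← iSup_vertexCharts_eq_top k n a b c d]
  refine sup_le (sup_le (sup_le ?_ ?_) (chart_two_le k n a b c d e h2)) le_sup_right
  · exact le_sup_left.trans (le_sup_left.trans le_sup_left)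
  · exact (chart_one_le_chart_zero_sup_chartW₁ k n a b c d).trans (le_sup_left.trans le_sup_left)

end Summit.ResolutionOfSingularities.ResolutionOfSingularities.Theorems.WildQuotientResolution.JordanFive

end
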